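import Literature.Barriers.QuantumAdvantage.AaronsonChenOracle
import Mathlib.Probability.Independence.InfinitePi
import Mathlib.Probability.Independence.Integration
import Mathlib.Probability.Moments.Basic
import HarnessLib

/-!
# Aaronson–Chen 2017, §5.3: the block structure of `𝒟_O`, the posterior bound and the per-transcript Chernoff bound

Proof file (D-0014: theorems only, plus the real definitions they are about) towards the named
fact `aaronsonChen2017_lem53_losses` of `AaronsonChenSimulation.lean` — the probabilistic half of
the proof of

* S. Aaronson, L. Chen, *Complexity-theoretic foundations of quantum supremacy experiments*,
  CCC 2017 (arXiv:1612.05903) [AaronsonChen2017], **Lemma 5.3** (§5.3, pp. 21–23).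

**The printed argument** (p. 22, "A posterior distribution", "Upper bounding the deviation",
"Applying the Chernoff Bound"). Knowledge of the oracle is a partial table `f_known`; "`𝒟^post` is
simply the distribution obtained from `𝒟_n` by conditioning on the event that `f` is consistent
with `f_known`"; "all the sets `B_{n,p}` … are still independent. So we can consider each set
separately": if a known string of the block is a `1` all others are `0`, otherwise "by Bayes' rule
… for each `y ∈ B_{n,p}` such that `f_known(y) = *`, with probability `2^{-n}/(2 − Z_p·2^{-n})`, `y`
is the only element of `B_{n,p}` that satisfies `f(y) = 1`", whence "`𝔼[f(x) ≠ g(x)] ≤ 2^{-n}`";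
the error term is `X = Σ_p X_p` with "all `X_p`'s independent", "`X_p ∈ [0, τ]`", `μ = 𝔼X ≤ 2^{-n}`,
and the multiplicative Chernoff bound (Lemma 2.6 / Cor. 2.7, p. 13: independent `X_i ∈ [0, τ]`,
`Pr[X ≥ (1+δ)μ] ≤ e^{−δμ/3τ}`) bounds `Pr[X ≥ ·]`.

**What is proved here**, on the coin space `(Set AcCoin, acCoinMeasure)` of which `𝒟_O` is the
image under `acOracleOf` (`AaronsonChenOracle.lean`), with no conditioning — the posterior
statements are proved in the joint form `Pr[C ∧ ·] ≤ Pr[C] · (·)`, `C` the knowledge event, which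
is what the union over transcripts in the sequel consumes:

* *block structure*: `coinLaw`, `coinEquiv`, `ofBlocks`, `blockProductMeasure`,
  `acCoinMeasure_eq_map_ofBlocks` (`acCoinMeasure` is the product over prefixes `p` of the block
  coin spaces: reindex `AcCoin ≃ List Bool × Option ℕ` and curry Mathlib's `infinitePi`),
  `blockData`/`blockDataFin` (the coins of block `p`) and **`iIndepFun_blockData`**,
  `iIndepFun_blockDataFin` (the blocks are independent, Mathlib `iIndepFun_infinitePi`),
  `integral_prod_blockDataFin` (expectations of products of block functions factor),
  `acCoinMeasure_blockDataFin_eq`, `integral_blockDataFin` (each block's `|p| + 1` coins are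
  uniform);
* *strings and blocks*: `halfPrefix`, `halfTail`, `BlockMem`, `mem_acOracleOf_iff_blockMem` (oracle
  membership is block-local), `eq_of_mem_acOracleOf_of_halfPrefix_eq` (one `1` per block),
  `acCoinMeasure_mem_acOracleOf` (`Pr[w ∈ O] = 2^{-(n+1)}`), `acCoinMeasure_inl_notMem`;
* *one transcript* (`K` known strings, answers `A`, weights `Q` on the unknown strings of length
  `2n`, scale `τ`): `unknownStrings`, `blocksOf`, `blockFactor`, `transcriptIntegrand` (the
  integrand `1_C · e^{X/τ}` as a product over blocks, `transcriptIntegrand_eq`), `blockEvent`,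
  `transcriptEvent` (`C_p`, `C`), `blockLoss`, `transcriptLoss` (`X_p`, `X`),
  `integral_transcriptIntegrand` (factorisation), **`measureReal_blockEvent_inter_le`** (the
  posterior bound `Pr[C_p ∧ w ∈ O] ≤ 2^{-n}·Pr[C_p]` for an unknown `w`), `blockLoss_le`
  (`X_p ∈ [0, τ]`), **`integral_blockFactor_le`** (the exponential moment
  `∫ 1_{C_p} e^{X_p/τ} ≤ Pr[C_p]·exp((e−1)·2^{-n}·q_p/τ)`), `measureReal_transcriptEvent_eq_prod`
  (`Pr[C] = ∏_p Pr[C_p]`), and **`measureReal_transcriptEvent_inter_le`** — the per-transcript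
  Chernoff bound `Pr[C ∧ X ≥ θ] ≤ Pr[C] · exp(−(θ − (e−1)·2^{-n})/τ)` (Markov on `1_C · e^{X/τ}`).

## Design notes

* The tree's `X_p` is the query magnitude of the unknown `1`s of the block (`AcSim.lossOf`); here
  it is abstracted to weights `Q w` (`= Q_t(1w)` in the sequel) with `0 ≤ Q ≤ τ` off `K` and total
  weight `≤ 1`, which is all the argument uses.
* Instead of Cor. 2.7 verbatim (`δ > 1`, relative to `μ`), the MGF step is run with `λ = 1/τ`:
  `e^{X_p/τ} ≤ 1 + (e−1)X_p/τ` on `[0, τ]` and `𝔼[X_p; C_p] ≤ 2^{-n} q_p Pr[C_p]`, giving the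
  additive form `exp(−(θ − (e−1)2^{-n})/τ)`, which is what the parameter choice of
  `aaronsonChen2017_lem53_losses` needs (there `2^{-n} ≪ θ`, the printed "`δ > 1`" regime; small
  blocks are fully known and contribute `X_p = 0`).
* Conditioning is avoided: for a product measure and a rectangle `C = ⋂_p C_p` the conditional
  law is again a product, and every statement is multiplied out by `Pr[C]`.

## Sources

* [AaronsonChen2017] arXiv:1612.05903, read via `lit read arxiv:1612.05903 --pages 11-14` and
  `--pages 19-25`: Lemma 2.6, Cor. 2.7 (p. 13), §5.2 (pp. 20–21, `𝒟_n`, `𝒟_O`, `B_{n,p}`), §5.3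
  (p. 22: posterior distribution, properties of `g`, `X_p`, Chernoff step).
* Mathlib: `ProbabilityTheory.setBernoulli_eq_map`, `Measure.infinitePi_map_piCongrLeft`,
  `Measure.infinitePi_map_curry_symm`, `ProbabilityTheory.iIndepFun_infinitePi`,
  `iIndepFun.integral_fun_prod_comp`, `mul_meas_ge_le_integral_of_nonneg` (Markov), `convexOn_exp`.
-/

noncomputable section

namespace Literature.Barriers.QuantumAdvantage

open MeasureTheory ProbabilityTheory Measure unitInterval

/-! ### The coin space as a product over blocks -/

/-- The fair coin on `Prop` of which `acCoinMeasure` is the product (`setBer(univ, 1/2)` unfolded).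
[cite: AaronsonChen2017, §5.2 (p. 20)] -/
def coinLaw : Measure Prop :=
  toNNReal (⟨1 / 2, by norm_num, by norm_num⟩ : unitInterval) • dirac True +
    toNNReal (σ ⟨1 / 2, by norm_num, by norm_num⟩) • dirac False

/-- The coin law is a probability measure. [folklore] -/
instance isProbabilityMeasure_coinLaw : IsProbabilityMeasure coinLaw := by
  unfold coinLaw; infer_instance

/-- `acCoinMeasure` is the image of the product of fair coins indexed by `AcCoin` under
`P ↦ {c | P c}`. [folklore] -/
theorem acCoinMeasure_eq_map_infinitePi :
    acCoinMeasure = (infinitePi fun _ : AcCoin => coinLaw).map fun P : AcCoin → Prop => {c | P c} := by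
  rw [acCoinMeasure, setBernoulli_eq_map]
  congr 2

/-- Coin coordinates as (block prefix, slot): slot `none` is the block coin, slot `some i` the
`i`-th position bit. [cite: AaronsonChen2017, §5.2 (pp. 20–21)] -/
def coinEquiv : List Bool × Option ℕ ≃ AcCoin where
  toFun q := match q with
    | (p, none) => Sum.inl p
    | (p, some i) => Sum.inr (p, i)
  invFun c := match c with
    | Sum.inl p => (p, none)
    | Sum.inr (p, i) => (p, some i)
  left_inv := by rintro ⟨p, _ | i⟩ <;> rfl
  right_inv := by rintro (p | ⟨p, i⟩) <;> rfl

/-- The block space: the coins of one block, indexed by the slot. [folklore] -/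
abbrev BlockSpace : Type := Option ℕ → Prop

/-- The product-over-blocks presentation of the coin space: from a family of blocks
`f : List Bool → BlockSpace` to the coin set `{c | f (block c) (slot c)}`. [folklore] -/
def ofBlocks (f : List Bool → BlockSpace) : Set AcCoin :=
  {c | f (coinEquiv.symm c).1 (coinEquiv.symm c).2}

/-- `ofBlocks` is measurable. [folklore] -/
theorem measurable_ofBlocks : Measurable ofBlocks := by
  refine measurable_set_iff.2 fun c => ?_
  change Measurable fun f : List Bool → BlockSpace => f (coinEquiv.symm c).1 (coinEquiv.symm c).2
  fun_prop

/-- The product measure over blocks of the product measure over slots. [folklore] -/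
def blockProductMeasure : Measure (List Bool → BlockSpace) :=
  infinitePi fun _ : List Bool => infinitePi fun _ : Option ℕ => coinLaw

/-- It is a probability measure. [folklore] -/
instance isProbabilityMeasure_blockProductMeasure : IsProbabilityMeasure blockProductMeasure := by
  unfold blockProductMeasure; infer_instance

/-- **`acCoinMeasure` is the product over blocks**: it is the image of `blockProductMeasure` under
`ofBlocks` (reindex the coins by (block, slot) and curry). [folklore] -/
theorem acCoinMeasure_eq_map_ofBlocks : acCoinMeasure = blockProductMeasure.map ofBlocks := by
  have h1 : (infinitePi fun _ : AcCoin => coinLaw) =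
      (infinitePi fun _ : List Bool × Option ℕ => coinLaw).map
        (MeasurableEquiv.piCongrLeft (fun _ : AcCoin => Prop) coinEquiv) :=
    (infinitePi_map_piCongrLeft (fun _ : AcCoin => coinLaw) coinEquiv).symm
  have h2 : (infinitePi fun _ : List Bool × Option ℕ => coinLaw) =
      blockProductMeasure.map (MeasurableEquiv.curry (List Bool) (Option ℕ) Prop).symm :=
    (infinitePi_map_curry_symm (fun (_ : List Bool) (_ : Option ℕ) => coinLaw)).symm
  rw [acCoinMeasure_eq_map_infinitePi, h1, h2, Measure.map_map (by fun_prop) (by fun_prop),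
    Measure.map_map (measurable_set_iff.2 fun c => by fun_prop) (by fun_prop)]
  congr 1
  funext f
  ext c
  simp only [Function.comp_apply, Set.mem_setOf_eq, ofBlocks]
  rw [show c = coinEquiv (coinEquiv.symm c) from (coinEquiv.apply_symm_apply c).symm,
    MeasurableEquiv.coe_piCongrLeft, Equiv.piCongrLeft_apply_apply, Equiv.symm_apply_apply]
  rfl

/-! ### Block data and its independence -/

/-- The data of the block of prefix `p` read off a coin set: the block coin and the position
bits (all of them; only the first `|p|` are used by `acOracleOf`). [cite: AaronsonChen2017, §5.2 (pp. 20–21)] -/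
def blockData (p : List Bool) (S : Set AcCoin) : Prop × (ℕ → Prop) :=
  (Sum.inl p ∈ S, fun i => Sum.inr (p, i) ∈ S)

/-- Reading a block is measurable. [folklore] -/
theorem measurable_blockData (p : List Bool) : Measurable (blockData p) :=
  (measurable_set_mem _).prodMk (measurable_pi_lambda _ fun _ => measurable_set_mem _)

/-- Reading the block data off a block space element. [folklore] -/
def blockDataOf (h : BlockSpace) : Prop × (ℕ → Prop) :=
  (h none, fun i => h (some i))

/-- `blockDataOf` is measurable. [folklore] -/
theorem measurable_blockDataOf : Measurable blockDataOf := by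
  unfold blockDataOf; fun_prop

/-- In the product presentation, the data of block `p` is read off the `p`-th factor. [folklore] -/
theorem blockData_ofBlocks (p : List Bool) (f : List Bool → BlockSpace) :
    blockData p (ofBlocks f) = blockDataOf (f p) := rfl

/-- **The blocks of `𝒟_O` are independent** ("all the sets `B_{n,p}` … are independent"; here for
the underlying coins: the block data of distinct prefixes are independent under `acCoinMeasure`).
[cite: AaronsonChen2017, §5.2 (p. 20) and §5.3 (p. 22, "all the sets B_{n,p} are still independent")] -/
theorem iIndepFun_blockData : iIndepFun (fun p S => blockData p S) acCoinMeasure := by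
  have hind : iIndepFun (fun p (f : List Bool → BlockSpace) => blockDataOf (f p)) blockProductMeasure :=
    iIndepFun_infinitePi (P := fun _ : List Bool => infinitePi fun _ : Option ℕ => coinLaw)
      (X := fun _ h => blockDataOf h) fun _ => measurable_blockDataOf
  have hmeas : ∀ p, Measurable fun f : List Bool → BlockSpace => blockDataOf (f p) := fun p =>
    measurable_blockDataOf.comp (measurable_pi_apply p)
  have hind' := (iIndepFun_iff_map_fun_eq_infinitePi_map hmeas).1 hind
  haveI : IsProbabilityMeasure (blockProductMeasure.map ofBlocks) :=
    Measure.isProbabilityMeasure_map measurable_ofBlocks.aemeasurable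
  rw [acCoinMeasure_eq_map_ofBlocks]
  rw [iIndepFun_iff_map_fun_eq_infinitePi_map fun p => measurable_blockData p]
  rw [Measure.map_map (measurable_pi_lambda _ fun p => measurable_blockData p) measurable_ofBlocks]
  have : (fun (S : Set AcCoin) p => blockData p S) ∘ ofBlocks = fun f p => blockDataOf (f p) := rfl
  rw [this, hind']
  congr 1
  funext p
  rw [Measure.map_map (measurable_blockData p) measurable_ofBlocks]
  rfl

/-! ### Truncated block data: a finite-valued, uniformly distributed summary of a block -/

/-- The data of block `p` used by the oracle: the block coin and the first `|p|` position bits.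
[cite: AaronsonChen2017, §5.2 (pp. 20–21)] -/
def blockDataFin (p : List Bool) (S : Set AcCoin) : Prop × (Fin p.length → Prop) :=
  (Sum.inl p ∈ S, fun i => Sum.inr (p, (i : ℕ)) ∈ S)

/-- Truncating block data to the first `n` position bits. [folklore] -/
def truncBlock (n : ℕ) (d : Prop × (ℕ → Prop)) : Prop × (Fin n → Prop) :=
  (d.1, fun i => d.2 i)

/-- Truncation is measurable. [folklore] -/
theorem measurable_truncBlock (n : ℕ) : Measurable (truncBlock n) := by
  unfold truncBlock; fun_prop

/-- The truncated data is the truncation of the block data (definitional). [folklore] -/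
theorem blockDataFin_eq (p : List Bool) (S : Set AcCoin) :
    blockDataFin p S = truncBlock p.length (blockData p S) := rfl

/-- Reading the truncated block data is measurable. [folklore] -/
theorem measurable_blockDataFin (p : List Bool) : Measurable (blockDataFin p) :=
  (measurable_truncBlock p.length).comp (measurable_blockData p)

/-- The truncated block data of distinct prefixes are independent. [cite: AaronsonChen2017, §5.2 (p. 20)] -/
theorem iIndepFun_blockDataFin : iIndepFun (fun p S => blockDataFin p S) acCoinMeasure :=
  iIndepFun_blockData.comp (fun p => truncBlock p.length) fun p => measurable_truncBlock p.length

/-- **Expectations of products of block functions factor** (independence of the blocks, for a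
finite set of prefixes). [cite: AaronsonChen2017, §5.3 (p. 22, "all X_p's are independent")] -/
theorem integral_prod_blockDataFin (P : Finset (List Bool))
    (g : (p : List Bool) → Prop × (Fin p.length → Prop) → ℝ) :
    ∫ S, ∏ p ∈ P, g p (blockDataFin p S) ∂acCoinMeasure =
      ∏ p ∈ P, ∫ S, g p (blockDataFin p S) ∂acCoinMeasure := by
  have h := iIndepFun_blockDataFin.precomp (g := fun i : P => (i : List Bool)) Subtype.val_injective
  have h2 := h.integral_fun_prod_comp (f := fun (i : P) d => g i d)
    (fun i => (measurable_blockDataFin (i : List Bool)).aemeasurable)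
    (fun i => (measurable_of_countable _).aestronglyMeasurable)
  rw [← Finset.prod_coe_sort P, ← h2]
  refine integral_congr_ae (ae_of_all _ fun S => ?_)
  exact (Finset.prod_coe_sort P fun p => g p (blockDataFin p S)).symm

/-- The law of the truncated block data: each of the `2^{|p|+1}` values has probability
`2^{-(|p|+1)}` (fair independent coins). [cite: AaronsonChen2017, §5.2 (pp. 20–21)] -/
theorem acCoinMeasure_blockDataFin_eq (p : List Bool) (d : Prop × (Fin p.length → Prop)) :
    acCoinMeasure {S | blockDataFin p S = d} = 2⁻¹ ^ (p.length + 1) := by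
  classical
  set s : Finset AcCoin :=
    insert (Sum.inl p) (Finset.univ.image fun i : Fin p.length => Sum.inr (p, (i : ℕ))) with hs
  set v : AcCoin → Prop := fun c => match c with
    | Sum.inl _ => d.1
    | Sum.inr (_, i) => if h : i < p.length then d.2 ⟨i, h⟩ else False with hv
  have hset : {S : Set AcCoin | blockDataFin p S = d} = {S | ∀ c ∈ s, c ∈ S ↔ v c} := by
    ext S
    simp only [Set.mem_setOf_eq, hs, Finset.mem_insert, Finset.mem_image, Finset.mem_univ,
      true_and, forall_eq_or_imp, hv, forall_exists_index, forall_apply_eq_imp_iff, Fin.is_lt,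
      dite_true, Fin.eta]
    constructor
    · rintro rfl
      exact ⟨Iff.rfl, fun i => Iff.rfl⟩
    · rintro ⟨h1, h2⟩
      refine Prod.ext (propext h1) (funext fun i => propext (h2 i))
  have hcard : s.card = p.length + 1 := by
    rw [hs, Finset.card_insert_of_notMem (by simp), Finset.card_image_of_injective _ fun i j hij => ?_,
      Finset.card_univ, Fintype.card_fin]
    simpa [Fin.ext_iff] using hij
  rw [hset, acCoinMeasure_cylinder, hcard]

/-- **Expectation of a block function**: the average over the `2^{|p|+1}` equally likely values of
the truncated block data. [cite: AaronsonChen2017, §5.2 (pp. 20–21)] -/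
theorem integral_blockDataFin (p : List Bool) (g : Prop × (Fin p.length → Prop) → ℝ) :
    ∫ S, g (blockDataFin p S) ∂acCoinMeasure = 2⁻¹ ^ (p.length + 1) * ∑ d, g d := by
  rw [← integral_map (measurable_blockDataFin p).aemeasurable
    (measurable_of_countable g).aestronglyMeasurable, integral_fintype Integrable.of_finite,
    Finset.mul_sum]
  refine Finset.sum_congr rfl fun d _ => ?_
  rw [measureReal_def, Measure.map_apply (measurable_blockDataFin p) (measurableSet_singleton d),
    smul_eq_mul]
  have : blockDataFin p ⁻¹' {d} = {S | blockDataFin p S = d} := rfl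
  rw [this, acCoinMeasure_blockDataFin_eq]
  simp [ENNReal.toReal_pow, ENNReal.toReal_inv]

/-! ### Blocks of strings: the prefix half and the tail half -/

/-- The prefix half of a string (its block, for an even-length string `p ++ e`, `|p| = |e|`).
[cite: AaronsonChen2017, §5.2 (p. 20, "B_{n,p} … the set of strings in {0,1}^{2n} with p as a prefix")] -/
def halfPrefix (w : List Bool) : List Bool := w.take (w.length / 2)

/-- The tail half of a string (its position inside its block). [cite: AaronsonChen2017, §5.2 (p. 20)] -/
def halfTail (w : List Bool) : List Bool := w.drop (w.length / 2)

/-- A string is its prefix half followed by its tail half. [folklore] -/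
theorem halfPrefix_append_halfTail (w : List Bool) : halfPrefix w ++ halfTail w = w :=
  List.take_append_drop _ _

/-- The prefix half has length `⌊|w|/2⌋`. [folklore] -/
@[simp] theorem length_halfPrefix (w : List Bool) : (halfPrefix w).length = w.length / 2 := by
  simp only [halfPrefix, List.length_take]; omega

/-- The tail half has length `|w| - ⌊|w|/2⌋`. [folklore] -/
@[simp] theorem length_halfTail (w : List Bool) : (halfTail w).length = w.length - w.length / 2 := by
  simp [halfTail]

/-- The two halves have the same length iff the string has even length. [folklore] -/
theorem length_halfTail_eq_iff (w : List Bool) :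
    (halfTail w).length = (halfPrefix w).length ↔ Even w.length := by
  rw [length_halfTail, length_halfPrefix, Nat.even_iff]; omega

/-- The halves of `p ++ e` with `|e| = |p|`. [folklore] -/
theorem halfPrefix_append {p e : List Bool} (he : e.length = p.length) : halfPrefix (p ++ e) = p := by
  simp only [halfPrefix, List.length_append, he]
  rw [show (p.length + p.length) / 2 = p.length by omega, List.take_left]

/-- The halves of `p ++ e` with `|e| = |p|`. [folklore] -/
theorem halfTail_append {p e : List Bool} (he : e.length = p.length) : halfTail (p ++ e) = e := by
  simp only [halfTail, List.length_append, he]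
  rw [show (p.length + p.length) / 2 = p.length by omega, List.drop_left]

/-- Membership of a tail in the block of prefix `p`, read off the truncated block data `d`: the
block coin is heads and the position bits spell the tail. [cite: AaronsonChen2017, §5.2 (pp. 20–21)] -/
def BlockMem (p : List Bool) (d : Prop × (Fin p.length → Prop)) (e : List Bool) : Prop :=
  e.length = p.length ∧ d.1 ∧ ∀ i : Fin p.length, d.2 i ↔ e.getD i false = true

/-- `p ++ e`, `|e| = |p|`, is in the oracle iff the block data of `p` says so. [cite: AaronsonChen2017, §5.2 (pp. 20–21)] -/
theorem append_mem_acOracleOf_iff {S : Set AcCoin} {p e : List Bool} (he : e.length = p.length) :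
    p ++ e ∈ acOracleOf S ↔ BlockMem p (blockDataFin p S) e := by
  have h := Set.ext_iff.1 (acOracleOf_preimage_mem p e he) S
  simp only [Set.mem_preimage, Set.mem_setOf_eq] at h
  rw [h]
  simp only [BlockMem, blockDataFin, he, true_and]
  refine and_congr_right fun _ => ?_
  constructor
  · intro h' i
    have hi : (i : ℕ) < e.length := by rw [he]; exact i.isLt
    rw [h' ⟨i, hi⟩]
    simp only [List.get_eq_getElem, List.getD_eq_getElem _ _ hi]
  · intro h' i
    have hi : (i : ℕ) < p.length := by rw [← he]; exact i.isLt
    rw [h' ⟨i, hi⟩]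
    simp only [List.get_eq_getElem, List.getD_eq_getElem _ _ i.isLt]

/-- **Oracle membership is block-local**: a string is in the oracle iff the block data of its
prefix half says its tail half is (odd-length strings are in no block and never in the oracle).
[cite: AaronsonChen2017, §5.2 (p. 20)] -/
theorem mem_acOracleOf_iff_blockMem (S : Set AcCoin) (w : List Bool) :
    w ∈ acOracleOf S ↔ BlockMem (halfPrefix w) (blockDataFin (halfPrefix w) S) (halfTail w) := by
  by_cases hw : Even w.length
  · have he : (halfTail w).length = (halfPrefix w).length := (length_halfTail_eq_iff w).2 hw
    rw [← append_mem_acOracleOf_iff he, halfPrefix_append_halfTail]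
  · constructor
    · exact fun h => absurd (even_length_of_mem_acOracleOf h) hw
    · exact fun h => absurd ((length_halfTail_eq_iff w).1 h.1) hw

/-- Two oracle strings of length `2|p|` in the block of `p` coincide (at most one `1` per block).
[cite: AaronsonChen2017, §5.2 (p. 20 and p. 22)] -/
theorem eq_of_mem_acOracleOf_of_halfPrefix_eq {S : Set AcCoin} {w w' : List Bool}
    (hw : w ∈ acOracleOf S) (hw' : w' ∈ acOracleOf S) (hp : halfPrefix w = halfPrefix w') : w = w' := by
  have he : (halfTail w).length = (halfPrefix w).length :=
    (length_halfTail_eq_iff w).2 (even_length_of_mem_acOracleOf hw)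
  have he' : (halfTail w').length = (halfPrefix w').length :=
    (length_halfTail_eq_iff w').2 (even_length_of_mem_acOracleOf hw')
  rw [← halfPrefix_append_halfTail w] at hw
  rw [← halfPrefix_append_halfTail w', ← hp] at hw'
  have := acOracleOf_block_unique hw hw' he (by rw [he', ← hp])
  rw [← halfPrefix_append_halfTail w, ← halfPrefix_append_halfTail w', this, hp]

/-- A string of length `2|p|` in the block of `p` is in the oracle only if the block coin of `p` is
heads. [cite: AaronsonChen2017, §5.2 (p. 20)] -/
theorem inl_mem_of_mem_acOracleOf {S : Set AcCoin} {w : List Bool} (hw : w ∈ acOracleOf S) :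
    Sum.inl (halfPrefix w) ∈ S :=
  ((mem_acOracleOf_iff_blockMem S w).1 hw).2.1

/-- The probability that a given string of even length `2m` is in the oracle is `2^{-(m+1)}`, on the
coin space. [cite: AaronsonChen2017, §5.2 (pp. 20–21)] -/
theorem acCoinMeasure_mem_acOracleOf {w : List Bool} (hw : Even w.length) :
    acCoinMeasure {S | w ∈ acOracleOf S} = 2⁻¹ ^ ((halfPrefix w).length + 1) := by
  have he : (halfTail w).length = (halfPrefix w).length := (length_halfTail_eq_iff w).2 hw
  have h := acOracleMeasure_mem_eq (halfPrefix w) (halfTail w) he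
  rw [halfPrefix_append_halfTail, acOracleMeasure,
    Measure.map_apply measurable_acOracleOf (measurableSet_mem _)] at h
  exact h

/-- The block coin is tails with probability `1/2`. [folklore] -/
theorem acCoinMeasure_inl_notMem (p : List Bool) :
    acCoinMeasure {S | Sum.inl p ∉ S} = 1 / 2 := by
  have h := acCoinMeasure_cylinder {Sum.inl p} fun _ => False
  simp only [Finset.mem_singleton, forall_eq, iff_false, Finset.card_singleton, pow_one] at h
  rw [h, one_div]

/-! ### One transcript: the knowledge event and the error term, block by block -/

section Transcript

open scoped Classical

/-- The strings of a given length, as a finite set. [folklore] -/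
def stringsOfLen (m : ℕ) : Finset (List Bool) := (List.finite_length_eq Bool m).toFinset

/-- Membership in `stringsOfLen`. [folklore] -/
@[simp] theorem mem_stringsOfLen {m : ℕ} {w : List Bool} : w ∈ stringsOfLen m ↔ w.length = m := by
  simp [stringsOfLen]

variable (K : Finset (List Bool)) (A : Set (List Bool)) (n : ℕ) (Q : List Bool → ℝ) (τ : ℝ)

/-- The unknown strings of length `2n`: those not in the knowledge `K` (the positions with
`f_known = *`). [cite: AaronsonChen2017, §5.3 (p. 22, "f_known")] -/
def unknownStrings : Finset (List Bool) := (stringsOfLen (2 * n)).filter (· ∉ K)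

/-- The blocks touched by a transcript: the prefix halves of the known strings and of the unknown
strings of length `2n`. [cite: AaronsonChen2017, §5.3 (p. 22)] -/
def blocksOf : Finset (List Bool) := (K ∪ unknownStrings K n).image halfPrefix

/-- The factor of block `p` in the integrand `1_C · exp(X/τ)`: the indicator that the block data is
consistent with the answers `A` on the known strings of the block, times `exp` of the block's share
of the error term. [cite: AaronsonChen2017, §5.3 (p. 22, "X_p = Σ_{x ∈ B_{n,p}} Q(x)·[f(x) ≠ g(x)]")] -/
def blockFactor (p : List Bool) (d : Prop × (Fin p.length → Prop)) : ℝ :=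
  (∏ w ∈ K.filter (halfPrefix · = p), if (BlockMem p d (halfTail w) ↔ w ∈ A) then (1 : ℝ) else 0) *
    Real.exp ((∑ w ∈ (unknownStrings K n).filter (halfPrefix · = p),
      if BlockMem p d (halfTail w) then Q w else 0) / τ)

/-- The integrand `1_C · exp(X/τ)` as a product over the touched blocks. [cite: AaronsonChen2017, §5.3 (p. 22)] -/
def transcriptIntegrand (S : Set AcCoin) : ℝ :=
  ∏ p ∈ blocksOf K n, blockFactor K A n Q τ p (blockDataFin p S)

/-- The knowledge event of block `p`: the oracle agrees with the answers on the known strings of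
the block. [cite: AaronsonChen2017, §5.3 (p. 22, "conditioning on the event that f is consistent with f_known")] -/
def blockEvent (p : List Bool) : Set (Set AcCoin) :=
  {S | ∀ w ∈ K.filter (halfPrefix · = p), w ∈ acOracleOf S ↔ w ∈ A}

/-- The knowledge event of the transcript: the oracle agrees with the answers `A` on `K`.
[cite: AaronsonChen2017, §5.3 (p. 22)] -/
def transcriptEvent : Set (Set AcCoin) :=
  {S | ∀ w ∈ K, w ∈ acOracleOf S ↔ w ∈ A}

/-- The error term of block `p`: `X_p = Σ_{unknown w in the block} Q(w)·[w ∈ O]`.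
[cite: AaronsonChen2017, §5.3 (p. 22, "X_p")] -/
def blockLoss (p : List Bool) (S : Set AcCoin) : ℝ :=
  ∑ w ∈ (unknownStrings K n).filter (halfPrefix · = p), if w ∈ acOracleOf S then Q w else 0

/-- The error term of the transcript: `X = Σ_{unknown w of length 2n} Q(w)·[w ∈ O]`.
[cite: AaronsonChen2017, §5.3 (p. 22, "X = Σ_x Q(x)·[f(x) ≠ g(x)]")] -/
def transcriptLoss (S : Set AcCoin) : ℝ :=
  ∑ w ∈ unknownStrings K n, if w ∈ acOracleOf S then Q w else 0

/-- The known strings lie in touched blocks. [folklore] -/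
theorem halfPrefix_mem_blocksOf_of_mem {w : List Bool} (hw : w ∈ K) : halfPrefix w ∈ blocksOf K n :=
  Finset.mem_image_of_mem _ (Finset.mem_union_left _ hw)

/-- The unknown strings lie in touched blocks. [folklore] -/
theorem halfPrefix_mem_blocksOf_of_mem_unknown {w : List Bool} (hw : w ∈ unknownStrings K n) :
    halfPrefix w ∈ blocksOf K n :=
  Finset.mem_image_of_mem _ (Finset.mem_union_right _ hw)

/-- **The block factor in oracle terms**: on the coin space, the factor of block `p` is the
indicator of the block's knowledge event times `exp(X_p/τ)`. [cite: AaronsonChen2017, §5.3 (p. 22)] -/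
theorem blockFactor_blockDataFin (p : List Bool) (S : Set AcCoin) :
    blockFactor K A n Q τ p (blockDataFin p S) =
      (if S ∈ blockEvent K A p then (1 : ℝ) else 0) * Real.exp (blockLoss K n Q p S / τ) := by
  have key : ∀ w : List Bool, halfPrefix w = p →
      (BlockMem p (blockDataFin p S) (halfTail w) ↔ w ∈ acOracleOf S) := by
    rintro w rfl
    exact (mem_acOracleOf_iff_blockMem S w).symm
  unfold blockFactor blockLoss blockEvent
  congr 1
  · rw [Finset.prod_boole]
    simp only [Set.mem_setOf_eq]
    congr 1
    refine propext (forall₂_congr fun w hw => ?_)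
    rw [key w (Finset.mem_filter.1 hw).2]
  · congr 2
    refine Finset.sum_congr rfl fun w hw => ?_
    rw [key w (Finset.mem_filter.1 hw).2]

/-- **The integrand in oracle terms**: `∏_p blockFactor_p = 1_C · exp(X/τ)`.
[cite: AaronsonChen2017, §5.3 (p. 22)] -/
theorem transcriptIntegrand_eq (S : Set AcCoin) :
    transcriptIntegrand K A n Q τ S =
      (if S ∈ transcriptEvent K A then (1 : ℝ) else 0) * Real.exp (transcriptLoss K n Q S / τ) := by
  unfold transcriptIntegrand
  simp only [blockFactor_blockDataFin, Finset.prod_mul_distrib]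
  congr 1
  · rw [Finset.prod_boole]
    congr 1
    simp only [blockEvent, transcriptEvent, Set.mem_setOf_eq]
    refine propext ⟨fun h w hw => ?_, fun h p _ w hw => h w (Finset.mem_filter.1 hw).1⟩
    exact h (halfPrefix w) (halfPrefix_mem_blocksOf_of_mem K n hw) w (Finset.mem_filter.2 ⟨hw, rfl⟩)
  · rw [← Real.exp_sum, ← Finset.sum_div]
    congr 2
    unfold blockLoss transcriptLoss
    exact Finset.sum_fiberwise_of_maps_to (fun w hw => halfPrefix_mem_blocksOf_of_mem_unknown K n hw) _

/-- The integrand is a measurable function of the coins (a product of functions of finitely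
valued block data). [folklore] -/
theorem measurable_transcriptIntegrand : Measurable (transcriptIntegrand K A n Q τ) := by
  unfold transcriptIntegrand
  refine Finset.measurable_prod _ fun p _ => ?_
  exact (measurable_of_countable (blockFactor K A n Q τ p)).comp (measurable_blockDataFin p)

/-- The block factor, read on the coin space, is measurable. [folklore] -/
theorem measurable_blockFactor_blockDataFin (p : List Bool) :
    Measurable fun S => blockFactor K A n Q τ p (blockDataFin p S) :=
  (measurable_of_countable (blockFactor K A n Q τ p)).comp (measurable_blockDataFin p)

/-- **The integral of the integrand factors over the blocks.** [cite: AaronsonChen2017, §5.3 (p. 22, "all X_p's are independent")] -/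
theorem integral_transcriptIntegrand :
    ∫ S, transcriptIntegrand K A n Q τ S ∂acCoinMeasure =
      ∏ p ∈ blocksOf K n, ∫ S, blockFactor K A n Q τ p (blockDataFin p S) ∂acCoinMeasure :=
  integral_prod_blockDataFin (blocksOf K n) (blockFactor K A n Q τ)

/-! ### The per-block bound (posterior of `𝒟_n` and the exponential moment of `X_p`) -/

/-- The event "the string `w` is in the oracle" is measurable on the coin space. [folklore] -/
theorem measurableSet_mem_acOracleOf (w : List Bool) : MeasurableSet {S : Set AcCoin | w ∈ acOracleOf S} :=
  measurable_acOracleOf (measurableSet_mem w)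

/-- Knowledge events of blocks are measurable. [folklore] -/
theorem measurableSet_blockEvent (p : List Bool) : MeasurableSet (blockEvent K A p) := by
  have : blockEvent K A p = ⋂ w ∈ K.filter (halfPrefix · = p), {S | w ∈ acOracleOf S ↔ w ∈ A} := by
    ext S; simp [blockEvent]
  rw [this]
  refine Finset.measurableSet_biInter _ fun w _ => measurableSet_setOf.2 ?_
  exact (measurableSet_setOf.1 (measurableSet_mem_acOracleOf w)).iff measurable_const

/-- Knowledge events of transcripts are measurable. [folklore] -/
theorem measurableSet_transcriptEvent : MeasurableSet (transcriptEvent K A) := by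
  have : transcriptEvent K A = ⋂ w ∈ K, {S | w ∈ acOracleOf S ↔ w ∈ A} := by
    ext S; simp [transcriptEvent]
  rw [this]
  refine Finset.measurableSet_biInter _ fun w _ => measurableSet_setOf.2 ?_
  exact (measurableSet_setOf.1 (measurableSet_mem_acOracleOf w)).iff measurable_const

/-- An unknown string of block `p` has length `2n`, is not known, and `|p| = n`. [folklore] -/
theorem of_mem_unknown_filter {p w : List Bool}
    (hw : w ∈ (unknownStrings K n).filter (halfPrefix · = p)) :
    w.length = 2 * n ∧ w ∉ K ∧ halfPrefix w = p ∧ p.length = n := by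
  simp only [unknownStrings, Finset.mem_filter, mem_stringsOfLen] at hw
  obtain ⟨⟨hl, hK⟩, hp⟩ := hw
  refine ⟨hl, hK, hp, ?_⟩
  rw [← hp, length_halfPrefix, hl]
  omega

/-- **The posterior bound** ("by Bayes' rule … for each `y ∈ B_{n,p}` such that `f_known(y) = *`,
with probability `2^{-n}/(2 − Z_p·2^{-n})`, `y` is the only element of `B_{n,p}` that satisfies
`f(y) = 1`"; hence "`f(x) = 1` with probability at most `2^{-n}`"): for an unknown string `w` of
block `p`, `Pr[C_p ∧ w ∈ O] ≤ 2^{-n} · Pr[C_p]`, `C_p` the knowledge event of the block. (If a known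
string of the block is a `1` the left side vanishes; otherwise `Pr[w ∈ O] = 2^{-(n+1)}` and
`Pr[C_p] ≥ Pr[block coin tails] = 1/2`.) [cite: AaronsonChen2017, §5.3 (p. 22, "A posterior distribution" and the claim E[f(x) ≠ g(x)] ≤ 2^{-n})] -/
theorem measureReal_blockEvent_inter_le (p : List Bool) {w : List Bool}
    (hw : w ∈ (unknownStrings K n).filter (halfPrefix · = p)) :
    acCoinMeasure.real (blockEvent K A p ∩ {S | w ∈ acOracleOf S}) ≤
      2⁻¹ ^ n * acCoinMeasure.real (blockEvent K A p) := by
  obtain ⟨hl, hK, hp, hpl⟩ := of_mem_unknown_filter K n hw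
  by_cases hA : ∃ w₀ ∈ K.filter (halfPrefix · = p), w₀ ∈ A
  · obtain ⟨w₀, hw₀, hw₀A⟩ := hA
    have hempty : blockEvent K A p ∩ {S | w ∈ acOracleOf S} = ∅ := by
      ext S
      simp only [Set.mem_inter_iff, Set.mem_setOf_eq, Set.mem_empty_iff_false, iff_false, not_and]
      intro hS hwS
      have h₀ : w₀ ∈ acOracleOf S := (hS w₀ hw₀).2 hw₀A
      have : w₀ = w :=
        eq_of_mem_acOracleOf_of_halfPrefix_eq h₀ hwS ((Finset.mem_filter.1 hw₀).2.trans hp.symm)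
      exact hK (this ▸ (Finset.mem_filter.1 hw₀).1)
    rw [hempty, measureReal_empty]
    positivity
  · push Not at hA
    have h1 : acCoinMeasure.real (blockEvent K A p ∩ {S | w ∈ acOracleOf S}) ≤ 2⁻¹ ^ (n + 1) := by
      calc acCoinMeasure.real (blockEvent K A p ∩ {S | w ∈ acOracleOf S})
          ≤ acCoinMeasure.real {S | w ∈ acOracleOf S} :=
            measureReal_mono Set.inter_subset_right (measure_ne_top _ _)
        _ = 2⁻¹ ^ (n + 1) := by
            rw [measureReal_def, acCoinMeasure_mem_acOracleOf (by rw [hl]; exact even_two_mul n), hp, hpl]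
            simp [ENNReal.toReal_pow, ENNReal.toReal_inv]
    have h2 : (1 : ℝ) / 2 ≤ acCoinMeasure.real (blockEvent K A p) := by
      calc (1 : ℝ) / 2 = acCoinMeasure.real {S | Sum.inl p ∉ S} := by
            rw [measureReal_def, acCoinMeasure_inl_notMem]
            simp
        _ ≤ acCoinMeasure.real (blockEvent K A p) := by
            refine measureReal_mono (fun S hS w' hw' => ?_) (measure_ne_top _ _)
            have hw'O : w' ∉ acOracleOf S := fun h => hS (by
              have := inl_mem_of_mem_acOracleOf h
              rwa [(Finset.mem_filter.1 hw').2] at this)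
            exact iff_of_false hw'O (hA w' hw')
    calc acCoinMeasure.real (blockEvent K A p ∩ {S | w ∈ acOracleOf S}) ≤ 2⁻¹ ^ (n + 1) := h1
      _ = 2⁻¹ ^ n * (1 / 2) := by ring
      _ ≤ 2⁻¹ ^ n * acCoinMeasure.real (blockEvent K A p) := by gcongr

/-- The error term of a block is nonnegative. [folklore] -/
theorem blockLoss_nonneg (hQ0 : ∀ w ∈ unknownStrings K n, 0 ≤ Q w) (p : List Bool) (S : Set AcCoin) :
    0 ≤ blockLoss K n Q p S :=
  Finset.sum_nonneg fun w hw => by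
    split_ifs
    · exact hQ0 w (Finset.mem_filter.1 hw).1
    · exact le_rfl

/-- **`X_p ∈ [0, τ]`**: at most one unknown string of the block is a `1` ("by properties (1) and
(3), there is at most one `x ∈ B_{n,p}` such that `f(x) ≠ g(x)`, and that `x` must satisfy
`Q(x) ≤ τ`. Therefore `X_p ∈ [0, τ]`"). [cite: AaronsonChen2017, §5.3 (p. 22)] -/
theorem blockLoss_le (hQτ : ∀ w ∈ unknownStrings K n, Q w ≤ τ)
    (hτ : 0 ≤ τ) (p : List Bool) (S : Set AcCoin) : blockLoss K n Q p S ≤ τ := by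
  unfold blockLoss
  rw [← Finset.sum_filter]
  set F := ((unknownStrings K n).filter (halfPrefix · = p)).filter (· ∈ acOracleOf S) with hF
  rcases F.eq_empty_or_nonempty with h | ⟨w₀, hw₀⟩
  · rw [h, Finset.sum_empty]; exact hτ
  · have hF1 : F = {w₀} := by
      refine Finset.eq_singleton_iff_unique_mem.2 ⟨hw₀, fun w hw => ?_⟩
      have hw' := Finset.mem_filter.1 hw
      have hw₀' := Finset.mem_filter.1 hw₀
      exact eq_of_mem_acOracleOf_of_halfPrefix_eq hw'.2 hw₀'.2
        ((Finset.mem_filter.1 hw'.1).2.trans (Finset.mem_filter.1 hw₀'.1).2.symm)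
    rw [hF1, Finset.sum_singleton]
    exact hQτ w₀ (Finset.mem_filter.1 (Finset.mem_filter.1 hw₀).1).1

/-- Convexity of `exp` on `[0, 1]`, scaled: `exp(y/τ) ≤ 1 + (e − 1)·(y/τ)` for `0 ≤ y ≤ τ`.
[cite: AaronsonChen2017, §2.4 (Lemma 2.6, the standard MGF step)] -/
theorem exp_div_le_one_add {y τ : ℝ} (hτ : 0 < τ) (h0 : 0 ≤ y) (h1 : y ≤ τ) :
    Real.exp (y / τ) ≤ 1 + (Real.exp 1 - 1) * (y / τ) := by
  set t := y / τ with ht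
  have ht0 : 0 ≤ t := div_nonneg h0 hτ.le
  have ht1 : t ≤ 1 := (div_le_one hτ).2 h1
  have h := convexOn_exp.2 (Set.mem_univ 0) (Set.mem_univ 1) (sub_nonneg.2 ht1) ht0 (by ring)
  simp only [smul_eq_mul, mul_zero, zero_add, mul_one, Real.exp_zero] at h
  linarith

/-- **The exponential moment of one block**: `∫ 1_{C_p} e^{X_p/τ} ≤ Pr[C_p] · exp((e−1)·2^{-n}·q_p/τ)`,
`q_p` the total weight of the unknown strings of the block (from `e^{X_p/τ} ≤ 1 + (e−1)X_p/τ`, the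
posterior bound string by string, and `1 + u ≤ e^u`). This is the tree's form of the MGF estimate
behind the multiplicative Chernoff bound Cor. 2.7 for the `[0, τ]`-valued `X_p`.
[cite: AaronsonChen2017, §5.3 (p. 22) and Cor. 2.7 (p. 13)] -/
theorem integral_blockFactor_le (hτ : 0 < τ) (hQ0 : ∀ w ∈ unknownStrings K n, 0 ≤ Q w)
    (hQτ : ∀ w ∈ unknownStrings K n, Q w ≤ τ) (p : List Bool) :
    ∫ S, blockFactor K A n Q τ p (blockDataFin p S) ∂acCoinMeasure ≤
      acCoinMeasure.real (blockEvent K A p) *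
        Real.exp ((Real.exp 1 - 1) * 2⁻¹ ^ n *
          (∑ w ∈ (unknownStrings K n).filter (halfPrefix · = p), Q w) / τ) := by
  have hEm : MeasurableSet (blockEvent K A p) := measurableSet_blockEvent K A p
  have hEw : ∀ w, MeasurableSet (blockEvent K A p ∩ {S | w ∈ acOracleOf S}) := fun w =>
    hEm.inter (measurableSet_mem_acOracleOf w)
  have he1 : 0 ≤ Real.exp 1 - 1 := by linarith [Real.add_one_le_exp (1 : ℝ)]
  have hc : 0 ≤ (Real.exp 1 - 1) / τ := div_nonneg he1 hτ.le
  -- pointwise bound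
  have hpt : ∀ S, blockFactor K A n Q τ p (blockDataFin p S) ≤
      (blockEvent K A p).indicator 1 S + (Real.exp 1 - 1) / τ *
        ∑ w ∈ (unknownStrings K n).filter (halfPrefix · = p),
          Q w * (blockEvent K A p ∩ {S | w ∈ acOracleOf S}).indicator 1 S := by
    intro S
    rw [blockFactor_blockDataFin]
    by_cases hS : S ∈ blockEvent K A p
    · have hsum : ∑ w ∈ (unknownStrings K n).filter (halfPrefix · = p),
          Q w * (blockEvent K A p ∩ {S | w ∈ acOracleOf S}).indicator 1 S = blockLoss K n Q p S := by
        unfold blockLoss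
        refine Finset.sum_congr rfl fun w _ => ?_
        by_cases hw : w ∈ acOracleOf S
        · rw [Set.indicator_of_mem (Set.mem_inter hS hw), if_pos hw]; simp
        · rw [Set.indicator_of_notMem (fun h => hw h.2), if_neg hw]; simp
      rw [if_pos hS, one_mul, Set.indicator_of_mem hS, Pi.one_apply, hsum]
      have := exp_div_le_one_add hτ (blockLoss_nonneg K n Q hQ0 p S) (blockLoss_le K n Q τ hQτ hτ.le p S)
      calc Real.exp (blockLoss K n Q p S / τ) ≤ 1 + (Real.exp 1 - 1) * (blockLoss K n Q p S / τ) := this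
        _ = 1 + (Real.exp 1 - 1) / τ * blockLoss K n Q p S := by ring
    · rw [if_neg hS, zero_mul, Set.indicator_of_notMem hS, zero_add]
      refine mul_nonneg hc (Finset.sum_nonneg fun w hw => mul_nonneg ?_ ?_)
      · exact hQ0 w (Finset.mem_filter.1 hw).1
      · exact Set.indicator_nonneg (fun _ _ => zero_le_one) _
  -- integrability
  have hf_int : Integrable (fun S => blockFactor K A n Q τ p (blockDataFin p S)) acCoinMeasure := by
    refine Integrable.of_bound (measurable_blockFactor_blockDataFin K A n Q τ p).aestronglyMeasurable
      (Real.exp 1) (ae_of_all _ fun S => ?_)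
    rw [Real.norm_eq_abs, blockFactor_blockDataFin]
    have hb : Real.exp (blockLoss K n Q p S / τ) ≤ Real.exp 1 :=
      Real.exp_le_exp.2 ((div_le_one hτ).2 (blockLoss_le K n Q τ hQτ hτ.le p S))
    split_ifs
    · rw [one_mul, abs_of_nonneg (Real.exp_pos _).le]; exact hb
    · rw [zero_mul, abs_zero]; positivity
  have hind_int : ∀ w, Integrable
      (fun S => Q w * (blockEvent K A p ∩ {S | w ∈ acOracleOf S}).indicator 1 S) acCoinMeasure :=
    fun w => ((integrable_const (1 : ℝ)).indicator (hEw w)).const_mul (Q w)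
  have h1 : Integrable (fun S => (blockEvent K A p).indicator (1 : Set AcCoin → ℝ) S) acCoinMeasure :=
    (integrable_const (1 : ℝ)).indicator hEm
  have h2 : Integrable (fun S => (Real.exp 1 - 1) / τ *
      ∑ w ∈ (unknownStrings K n).filter (halfPrefix · = p),
        Q w * (blockEvent K A p ∩ {S | w ∈ acOracleOf S}).indicator 1 S) acCoinMeasure :=
    (integrable_finsetSum _ fun w _ => hind_int w).const_mul _
  -- integrate
  calc ∫ S, blockFactor K A n Q τ p (blockDataFin p S) ∂acCoinMeasure
      ≤ ∫ S, ((blockEvent K A p).indicator 1 S + (Real.exp 1 - 1) / τ *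
          ∑ w ∈ (unknownStrings K n).filter (halfPrefix · = p),
            Q w * (blockEvent K A p ∩ {S | w ∈ acOracleOf S}).indicator 1 S) ∂acCoinMeasure :=
        integral_mono hf_int (h1.add h2) hpt
    _ = acCoinMeasure.real (blockEvent K A p) + (Real.exp 1 - 1) / τ *
          ∑ w ∈ (unknownStrings K n).filter (halfPrefix · = p),
            Q w * acCoinMeasure.real (blockEvent K A p ∩ {S | w ∈ acOracleOf S}) := by
        rw [integral_add h1 h2, integral_indicator_one hEm, integral_const_mul,
          integral_finsetSum _ fun w _ => hind_int w]
        congr 2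
        refine Finset.sum_congr rfl fun w _ => ?_
        rw [integral_const_mul, integral_indicator_one (hEw w)]
    _ ≤ acCoinMeasure.real (blockEvent K A p) + (Real.exp 1 - 1) / τ *
          ∑ w ∈ (unknownStrings K n).filter (halfPrefix · = p),
            Q w * (2⁻¹ ^ n * acCoinMeasure.real (blockEvent K A p)) := by
        refine add_le_add le_rfl (mul_le_mul_of_nonneg_left (Finset.sum_le_sum fun w hw => ?_) hc)
        exact mul_le_mul_of_nonneg_left (measureReal_blockEvent_inter_le K A n p hw)
          (hQ0 w (Finset.mem_filter.1 hw).1)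
    _ = acCoinMeasure.real (blockEvent K A p) *
          (1 + (Real.exp 1 - 1) * 2⁻¹ ^ n *
            (∑ w ∈ (unknownStrings K n).filter (halfPrefix · = p), Q w) / τ) := by
        rw [← Finset.sum_mul]
        ring
    _ ≤ acCoinMeasure.real (blockEvent K A p) *
          Real.exp ((Real.exp 1 - 1) * 2⁻¹ ^ n *
            (∑ w ∈ (unknownStrings K n).filter (halfPrefix · = p), Q w) / τ) := by
        refine mul_le_mul_of_nonneg_left ?_ measureReal_nonneg
        linarith [Real.add_one_le_exp ((Real.exp 1 - 1) * 2⁻¹ ^ n *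
          (∑ w ∈ (unknownStrings K n).filter (halfPrefix · = p), Q w) / τ)]

/-! ### The per-transcript Chernoff bound -/

/-- The integral of a `0/1`-valued `if` is the measure of the event. [folklore] -/
theorem integral_ite_mem_eq_measureReal {E : Set (Set AcCoin)} (hE : MeasurableSet E) :
    ∫ S, (if S ∈ E then (1 : ℝ) else 0) ∂acCoinMeasure = acCoinMeasure.real E := by
  rw [← integral_indicator_one hE]
  refine integral_congr_ae (ae_of_all _ fun S => ?_)
  by_cases h : S ∈ E <;> simp [h]

/-- With zero weights the block factor integrates to the probability of the block's knowledge
event. [folklore] -/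
theorem integral_blockFactor_zero (p : List Bool) :
    ∫ S, blockFactor K A n (fun _ => 0) τ p (blockDataFin p S) ∂acCoinMeasure =
      acCoinMeasure.real (blockEvent K A p) := by
  rw [← integral_ite_mem_eq_measureReal (measurableSet_blockEvent K A p)]
  refine integral_congr_ae (ae_of_all _ fun S => ?_)
  simp only [blockFactor_blockDataFin, blockLoss, ite_self, Finset.sum_const_zero, zero_div,
    Real.exp_zero, mul_one]

/-- With zero weights the integrand integrates to the probability of the knowledge event. [folklore] -/
theorem integral_transcriptIntegrand_zero :
    ∫ S, transcriptIntegrand K A n (fun _ => 0) τ S ∂acCoinMeasure =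
      acCoinMeasure.real (transcriptEvent K A) := by
  rw [← integral_ite_mem_eq_measureReal (measurableSet_transcriptEvent K A)]
  refine integral_congr_ae (ae_of_all _ fun S => ?_)
  simp only [transcriptIntegrand_eq, transcriptLoss, ite_self, Finset.sum_const_zero, zero_div,
    Real.exp_zero, mul_one]

/-- **The knowledge event factors over the blocks**: `Pr[C] = ∏_p Pr[C_p]` (independence of the
blocks). [cite: AaronsonChen2017, §5.3 (p. 22, "all the sets B_{n,p} are still independent")] -/
theorem measureReal_transcriptEvent_eq_prod :
    acCoinMeasure.real (transcriptEvent K A) =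
      ∏ p ∈ blocksOf K n, acCoinMeasure.real (blockEvent K A p) := by
  rw [← integral_transcriptIntegrand_zero K A n 1, integral_transcriptIntegrand]
  exact Finset.prod_congr rfl fun p _ => integral_blockFactor_zero K A n 1 p

/-- The error term of a transcript is nonnegative. [folklore] -/
theorem transcriptLoss_nonneg (hQ0 : ∀ w ∈ unknownStrings K n, 0 ≤ Q w) (S : Set AcCoin) :
    0 ≤ transcriptLoss K n Q S :=
  Finset.sum_nonneg fun w hw => by
    split_ifs
    · exact hQ0 w hw
    · exact le_rfl

/-- The error term of a transcript is at most the total weight. [folklore] -/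
theorem transcriptLoss_le_sum (hQ0 : ∀ w ∈ unknownStrings K n, 0 ≤ Q w) (S : Set AcCoin) :
    transcriptLoss K n Q S ≤ ∑ w ∈ unknownStrings K n, Q w :=
  Finset.sum_le_sum fun w hw => by
    split_ifs
    · exact le_rfl
    · exact hQ0 w hw

/-- **The Chernoff bound for one transcript** (Cor. 2.7 applied to `X = Σ_p X_p` under the
posterior, in the tree's unconditional form): for a knowledge `K` with answers `A`, weights
`0 ≤ Q ≤ τ` on the unknown strings of length `2n` with total weight `≤ 1`, and any threshold `θ`,
`Pr[C ∧ X ≥ θ] ≤ Pr[C] · exp(−(θ − (e−1)·2^{-n})/τ)` — Markov's inequality on `1_C · e^{X/τ}`, whose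
integral factors over the blocks (`integral_transcriptIntegrand`) into the per-block moments
(`integral_blockFactor_le`) and `Pr[C] = ∏_p Pr[C_p]`.
[cite: AaronsonChen2017, §5.3 (p. 22, "Applying the Chernoff Bound") and Cor. 2.7 (p. 13)] -/
theorem measureReal_transcriptEvent_inter_le (hτ : 0 < τ) (hQ0 : ∀ w ∈ unknownStrings K n, 0 ≤ Q w)
    (hQτ : ∀ w ∈ unknownStrings K n, Q w ≤ τ) (hQ1 : ∑ w ∈ unknownStrings K n, Q w ≤ 1) (θ : ℝ) :
    acCoinMeasure.real (transcriptEvent K A ∩ {S | θ ≤ transcriptLoss K n Q S}) ≤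
      acCoinMeasure.real (transcriptEvent K A) *
        Real.exp (-(θ - (Real.exp 1 - 1) * 2⁻¹ ^ n) / τ) := by
  have he1 : 0 ≤ Real.exp 1 - 1 := by linarith [Real.add_one_le_exp (1 : ℝ)]
  -- Step A: the integral of the integrand
  have hnonneg : ∀ p S, 0 ≤ blockFactor K A n Q τ p (blockDataFin p S) := fun p S => by
    rw [blockFactor_blockDataFin]
    split_ifs <;> positivity
  have hA : ∫ S, transcriptIntegrand K A n Q τ S ∂acCoinMeasure ≤
      acCoinMeasure.real (transcriptEvent K A) * Real.exp ((Real.exp 1 - 1) * 2⁻¹ ^ n / τ) := by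
    rw [integral_transcriptIntegrand]
    calc ∏ p ∈ blocksOf K n, ∫ S, blockFactor K A n Q τ p (blockDataFin p S) ∂acCoinMeasure
        ≤ ∏ p ∈ blocksOf K n, acCoinMeasure.real (blockEvent K A p) *
            Real.exp ((Real.exp 1 - 1) * 2⁻¹ ^ n *
              (∑ w ∈ (unknownStrings K n).filter (halfPrefix · = p), Q w) / τ) :=
          Finset.prod_le_prod (fun p _ => integral_nonneg (hnonneg p))
            fun p _ => integral_blockFactor_le K A n Q τ hτ hQ0 hQτ p
      _ = acCoinMeasure.real (transcriptEvent K A) *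
            Real.exp ((Real.exp 1 - 1) * 2⁻¹ ^ n * (∑ w ∈ unknownStrings K n, Q w) / τ) := by
          rw [Finset.prod_mul_distrib, ← Real.exp_sum, ← measureReal_transcriptEvent_eq_prod K A n,
            ← Finset.sum_div, ← Finset.mul_sum,
            Finset.sum_fiberwise_of_maps_to
              (fun w hw => halfPrefix_mem_blocksOf_of_mem_unknown K n hw) Q]
      _ ≤ acCoinMeasure.real (transcriptEvent K A) * Real.exp ((Real.exp 1 - 1) * 2⁻¹ ^ n / τ) := by
          refine mul_le_mul_of_nonneg_left (Real.exp_le_exp.2 ?_) measureReal_nonneg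
          rw [div_le_div_iff_of_pos_right hτ]
          have h2 : (0 : ℝ) ≤ (Real.exp 1 - 1) * 2⁻¹ ^ n := by positivity
          nlinarith
  -- Step B: Markov
  have hbound : ∀ S, transcriptIntegrand K A n Q τ S ≤ Real.exp (1 / τ) := fun S => by
    rw [transcriptIntegrand_eq]
    have : Real.exp (transcriptLoss K n Q S / τ) ≤ Real.exp (1 / τ) :=
      Real.exp_le_exp.2 (div_le_div_of_nonneg_right ((transcriptLoss_le_sum K n Q hQ0 S).trans hQ1) hτ.le)
    split_ifs
    · rw [one_mul]; exact this
    · rw [zero_mul]; positivity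
  have htI_nonneg : ∀ S, 0 ≤ transcriptIntegrand K A n Q τ S := fun S =>
    Finset.prod_nonneg fun p _ => hnonneg p S
  have hint : Integrable (fun S => Real.exp (-θ / τ) * transcriptIntegrand K A n Q τ S) acCoinMeasure := by
    refine (Integrable.of_bound (measurable_transcriptIntegrand K A n Q τ).aestronglyMeasurable
      (Real.exp (1 / τ)) (ae_of_all _ fun S => ?_)).const_mul _
    rw [Real.norm_eq_abs, abs_of_nonneg (htI_nonneg S)]
    exact hbound S
  have hsub : transcriptEvent K A ∩ {S | θ ≤ transcriptLoss K n Q S} ⊆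
      {S | 1 ≤ Real.exp (-θ / τ) * transcriptIntegrand K A n Q τ S} := by
    rintro S ⟨hC, hθ⟩
    simp only [Set.mem_setOf_eq] at hθ ⊢
    rw [transcriptIntegrand_eq, if_pos hC, one_mul, ← Real.exp_add]
    refine Real.one_le_exp ?_
    rw [neg_div, neg_add_eq_sub, sub_nonneg]
    exact div_le_div_of_nonneg_right hθ hτ.le
  have hM := mul_meas_ge_le_integral_of_nonneg
    (ae_of_all _ fun S => mul_nonneg (Real.exp_pos _).le (htI_nonneg S)) hint 1
  rw [one_mul] at hM
  -- Step C: combine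
  calc acCoinMeasure.real (transcriptEvent K A ∩ {S | θ ≤ transcriptLoss K n Q S})
      ≤ acCoinMeasure.real {S | 1 ≤ Real.exp (-θ / τ) * transcriptIntegrand K A n Q τ S} :=
        measureReal_mono hsub (measure_ne_top _ _)
    _ ≤ ∫ S, Real.exp (-θ / τ) * transcriptIntegrand K A n Q τ S ∂acCoinMeasure := hM
    _ = Real.exp (-θ / τ) * ∫ S, transcriptIntegrand K A n Q τ S ∂acCoinMeasure := integral_const_mul _ _
    _ ≤ Real.exp (-θ / τ) *
          (acCoinMeasure.real (transcriptEvent K A) * Real.exp ((Real.exp 1 - 1) * 2⁻¹ ^ n / τ)) :=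
        mul_le_mul_of_nonneg_left hA (Real.exp_pos _).le
    _ = acCoinMeasure.real (transcriptEvent K A) *
          Real.exp (-(θ - (Real.exp 1 - 1) * 2⁻¹ ^ n) / τ) := by
        rw [mul_left_comm, ← Real.exp_add]
        congr 2
        ring

end Transcript

end Literature.Barriers.QuantumAdvantage

end
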